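import Summits.Ventures.Crystal3D.Theorems.StickyWulffConstantNoReconstructionGainExactDefs
import HarnessLib

/-!
# The residual of the line `replication-exactness`, v4: confinement of the wrapped off-lattice part of a core
# (definition)

HONEST FRAMING. Part of the venture `Summits/Ventures/Crystal3D` (cell `crystal3d-full`), supports the
crux `NoReconstructionGain` (stmt-Ventures-19144, route `route-Ventures-StickyWulffConstant`), line
`replication-exactness` (lead wulff-p1 g17).  DEFINITION ONLY.  With EXACT₀, the LEVEL SANDWICH
(`…ExactLevel`) and `deficit_ge_of_exactZeroGain_sub_offLattice_deep` (`…ExactLevelDeep`) give the crux's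
inequality for every packing around the slab sample up to `12` per off-lattice ball of deep-band height
`(−2R+2, −R−2)` near the best interior level; such balls cannot lie over the disc, so they are WRAPPED
(outside the cylinder, in the height band of the slab).  What the crux then still needs from a core is
only that these balls are not too many:

* `CoreWrappedConfinement` — there are `L` and `R ≥ 8` such that for every unit normal `ν`, every
  `ρ ≥ R` and every unit packing `X ⊇ P_ρ(ν,R)` whose film is a P-CORE (every nonempty block of film
  balls strictly over-attached, verbatim the hypothesis of `adhesion_of_core`), the film has at most
  `L · ⌊(R−6)/2⌋ · ρ` off-lattice balls of `ν`-height in `(−2R+2, −R−2)`.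

This REPLACES the residual `WrappedCoreAdhesion` (UNWRAP) of skeleton v1–v3 in the composition (skeleton
v4): `NoCriminal ∧ CoreWrappedConfinement ⟹ NoReconstructionGain`.  Why plausibly true: a block of film
balls far outside the cylinder is bound to the rest only across a surface of size `O(R · ρ)` per unit
radial thickness while its own deficiency grows with its size (`D ≥ c·#^{2/3}` for packings), so strict
over-attachment of every block confines a core to a collar of bounded width around the cylinder wall,
whose deep band holds `O(R ρ)` balls.

WHAT THIS IS NOT: a theorem — definition only; nothing here proves the crux.
-/

noncomputable section

namespace Summit.Ventures.Crystal3D.Theorems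

open Literature.MathematicalPhysics.StatisticalMechanics (fccStacking contactDeficiency)
open scoped InnerProductSpace
open Finset

open scoped Classical in
/-- **CONFINEMENT of the wrapped off-lattice part of a core** (residual of the line
`replication-exactness`, skeleton v4): some `L` and `R ≥ 8` bound, for every unit `ν`, `ρ ≥ R` and every
unit packing around the slab sample `P_ρ(ν,R)` whose film is a P-core, the number of off-lattice film
balls of height in the deep band `(−2R+2, −R−2)` by `L · ⌊(R−6)/2⌋ · ρ`. -/
def CoreWrappedConfinement : Prop :=
  ∃ L R : ℝ, 8 ≤ R ∧ ∀ ν : EuclideanSpace ℝ (Fin 3), ‖ν‖ = 1 → ∀ ρ : ℝ, R ≤ ρ →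
    ∀ X P : Finset (EuclideanSpace ℝ (Fin 3)),
    (∀ p ∈ X, ∀ q ∈ X, p ≠ q → 1 ≤ dist p q) → P ⊆ X →
    (∀ p, p ∈ P ↔ (p ∈ fccStacking 1 (Real.sqrt (2 / 3)) ∧ -(2 * R) ≤ ⟪p, ν⟫_ℝ ∧
      ⟪p, ν⟫_ℝ ≤ -R ∧ ‖p‖ ^ 2 - ⟪p, ν⟫_ℝ ^ 2 ≤ ρ ^ 2)) →
    (∀ S, S ⊆ X \ P → S.Nonempty →
      contactDeficiency S <
        (((((X \ S) ×ˢ S).filter fun pq => dist pq.1 pq.2 = 1).card : ℕ) : ℝ)) →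
    (((X.filter fun x => x ∉ fccStacking 1 (Real.sqrt (2 / 3)) ∧ -(2 * R) + 2 < ⟪x, ν⟫_ℝ ∧
      ⟪x, ν⟫_ℝ < -R - 2).card : ℕ) : ℝ) ≤ L * (⌊(R - 6) / 2⌋₊ : ℕ) * ρ

end Summit.Ventures.Crystal3D.Theorems

end
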